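/-
Copyright (c) 2026 the pub-hodgecm-mathlib formalisation cell (harness21).  Prover seat hodgecm-mathlib-LH5-p03 (g3): the ★ feed of organ (Z3) «LEVEL-SCALAR STABILITY» of the
third-layer pay-down LH5c of X1 `stub_tprimeJ` (LH5-plan (g3) DEALER BOARD LH5 #1, 2026-09-02T10:21Z; LEAD T13-16, desk D100); 2026-09-02.
-/
import Literature.NumberTheory.Rogawski1990.TamagawaSingularFinPartnersExplicit   -- ★ p850513 D2 (LH5-p01 (g2)): `singularGuardSet`, `levelScalar`, `levelScalar_congr`; brings ★ `corresponds_toLocal_toAdelic` (`AdelicStableConjugacyG` §2)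
import Literature.NumberTheory.Rogawski1990.TamagawaSingularCovolumeTransport     -- ★ (K7-s) transport: `isStablyConj_out_of_stableClass_eq` (reused, not restated)
import HarnessLib

/-!
# The class-uniform level scalar `M_v(x)` is a STABLE-CLASS invariant: `M_v((γ)_v) = M_v((γ′)_v)` for stably conjugate rational `γ ∼_st γ′`, at every finite place `v`
# (Rogawski 1990 §3.1 p. 19, §4.3 pp. 43–44, §14.5 L. 14.5.2 (b); Kottwitz 1986 Prop. 7.1)

Topic `NumberTheory/Rogawski1990`; namespace `Literature.NumberTheory.Rogawski1990.TamagawaFinPartners` (home of ★ D2 `levelScalar`).  THEOREMS ONLY (no definition, no instance, no notation,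
no axiom, no named fact, no `sorry`).  Cell `pub/hodgecm-mathlib`, crux H413 = `stmt-HodgeConjecture-24833`, F0∕P3c line LH5 (closer stub `stub_S1finTFCovol`; LH5b leaf ED. 3 PRINT organ
X1 `stub_tprimeJ` «KOTTWITZ-T′ AT THE TAMAGAWA PARTNERS»): the ★ FEED of organ **(Z3) «LEVEL-SCALAR STABILITY»** of the third-layer pay-down LH5c (LH5-plan (g3) DEALER BOARD LH5 #1,
2026-09-02T10:21Z — «`∀ v, levelScalar v c_v = levelScalar v c′_v` for `c ∼_st c′` ⇐ ★ `Corresponds` = `IsConj` in the ambient `GL₃` ∘ ★ D2 `levelScalar_congr`»; LEAD F0P3a-plan (g14)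
T13-16 YES (structure), desk F0P3-plan (g15) D100); hand LH5-p03 (g3).  Kernel lane `--supports stmt-HodgeConjecture-24833`; count-neutral (the organ is DERIVED from the last head here
by one token once the LH5c skeleton is written; no organ text is guessed in this file).

THE MATHEMATICS.  ★ D2 puts `M_v(x) := ρ_v((γmin_v(x))_v)`, the Tamagawa density at the local image of the MINIMAL-RANK element of the guard set
`R_v(x) = {γ₀ ∈ U(H′)(L⁺) : γ₀ non-regular, (γ₀)_v ↔ x}` (`1` off the guard), so `M_v` is a function of `R_v(x)` alone (★ `levelScalar_congr`).  The local correspondence `↔` on the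
`cmDatum` carriers IS conjugacy in the ambient `GL₃(∏_{w∣v} L_w)` (★ `Corresponds` := `IsConj`), an equivalence relation: hence `R_v(x) = R_v(x′)` whenever `x ↔ x′` (§1), and for
rational `γ ∼_st γ′` (= conjugate in `GL₃(L)`, ★ `IsStablyConj`) the local images correspond at every `v` (★ `corresponds_toLocal_toAdelic`), so `M_v((γ)_v) = M_v((γ′)_v)` (§2); in X1's
own binders — two rational conjugacy classes `c, c′` with `StableClass.ofConjClass c = StableClass.ofConjClass c′` (★ `isStablyConj_out_of_stableClass_eq`) — this reads
`M_v((out c)_v) = M_v((out c′)_v)` for all `v` (§2, last head): the scalar `∏′_v λ_v M_v` by which the `t^J`-tower differs from Weil's `λ`-tower is the SAME on both sides of (T′).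

* §1 `corresponds_refl'`, `Corresponds.symm'`, `Corresponds.trans'` (the local `↔` on ONE group is an equivalence relation — dot-free names, no clash with ★ `corresponds_comm`),
  **`singularGuardSet_eq_of_corresponds`**, **`levelScalar_eq_of_corresponds`**.
* §2 **`singularGuardSet_toLocal_toAdelic_eq_of_isStablyConj`**, **`levelScalar_toLocal_toAdelic_eq_of_isStablyConj`**, **`levelScalar_toLocal_toAdelic_out_eq_of_stableClass_eq`** (THE (Z3) FEED).
HONEST LABEL: HC_CM is proved only modulo the 7 printed citations (2 remaining: hLiu418 = `stmt-HodgeConjecture-24832`, h413 = `stmt-HodgeConjecture-24833`) until rung 0 closes; bookkeeping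
over ★ D2, pays no organ by itself.

## References
* [Rogawski1990] J. D. Rogawski, *Automorphic Representations of Unitary Groups in Three Variables*, Ann. of Math. Stud. 123 (1990), §3.1 p. 19 (stable conjugacy = conjugacy in
  `GL₃`), §4.3 pp. 43–44, §14.5 Lemma 14.5.2 (b) pp. 238–239.
* [Kottwitz1986] R. E. Kottwitz, *Base change for unit elements of Hecke algebras*, Compositio Math. 60 (1986), Prop. 7.1.
-/

set_option autoImplicit false

noncomputable section

open MeasureTheory Measure Set NumberField IsDedekindDomain
open scoped Matrix MatrixGroups NNReal

namespace Literature.NumberTheory.Rogawski1990.TamagawaFinPartners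

open Literature.NumberTheory.Automorphic
open Literature.NumberTheory.Weil1982
open Literature.AlgebraicGeometry.ShimuraVarieties (unitaryGroup hermForm)

variable (L : Type) [Field L] [NumberField L] [IsCMField L] (H' : Matrix (Fin 3) (Fin 3) L) (v : HeightOneSpectrum (𝓞 ↥(maximalRealSubfield L)))

/-! ## §1 The guard set and the level scalar are local-`↔`-invariants -/

/-- The local correspondence `↔` on ONE group `U(H′)(L⁺_v)` is reflexive (it is `IsConj` in `GL₃(∏_{w∣v} L_w)`). [cite: Rogawski1990, §3.1 p. 19] -/
theorem corresponds_refl' (x : (UnitaryGroup.cmDatum L 3 H').Local v) :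
    Corresponds (UnitaryGroup.conjLocal L (IsCMField.complexConj L) v)
      ((UnitaryGroup.adelicForm L 3 H').map (UnitaryGroup.adeleToLocal L v))
      ((UnitaryGroup.adelicForm L 3 H').map (UnitaryGroup.adeleToLocal L v)) x x :=
  IsConj.refl _

variable {L H' v}

/-- The local correspondence `↔` on one group is symmetric. [cite: Rogawski1990, §3.1 p. 19] -/
theorem Corresponds.symm' {x x' : (UnitaryGroup.cmDatum L 3 H').Local v}
    (h : Corresponds (UnitaryGroup.conjLocal L (IsCMField.complexConj L) v)
      ((UnitaryGroup.adelicForm L 3 H').map (UnitaryGroup.adeleToLocal L v))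
      ((UnitaryGroup.adelicForm L 3 H').map (UnitaryGroup.adeleToLocal L v)) x x') :
    Corresponds (UnitaryGroup.conjLocal L (IsCMField.complexConj L) v)
      ((UnitaryGroup.adelicForm L 3 H').map (UnitaryGroup.adeleToLocal L v))
      ((UnitaryGroup.adelicForm L 3 H').map (UnitaryGroup.adeleToLocal L v)) x' x :=
  IsConj.symm h

/-- The local correspondence `↔` on one group is transitive. [cite: Rogawski1990, §3.1 p. 19] -/
theorem Corresponds.trans' {x x' x'' : (UnitaryGroup.cmDatum L 3 H').Local v}
    (h : Corresponds (UnitaryGroup.conjLocal L (IsCMField.complexConj L) v)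
      ((UnitaryGroup.adelicForm L 3 H').map (UnitaryGroup.adeleToLocal L v))
      ((UnitaryGroup.adelicForm L 3 H').map (UnitaryGroup.adeleToLocal L v)) x x')
    (h' : Corresponds (UnitaryGroup.conjLocal L (IsCMField.complexConj L) v)
      ((UnitaryGroup.adelicForm L 3 H').map (UnitaryGroup.adeleToLocal L v))
      ((UnitaryGroup.adelicForm L 3 H').map (UnitaryGroup.adeleToLocal L v)) x' x'') :
    Corresponds (UnitaryGroup.conjLocal L (IsCMField.complexConj L) v)
      ((UnitaryGroup.adelicForm L 3 H').map (UnitaryGroup.adeleToLocal L v))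
      ((UnitaryGroup.adelicForm L 3 H').map (UnitaryGroup.adeleToLocal L v)) x x'' :=
  IsConj.trans h h'

/-- **THE GUARD SET IS A LOCAL-`↔`-INVARIANT**: `x ↔ x′ ⇒ R_v(x) = R_v(x′)` (a rational non-regular `γ₀` with `(γ₀)_v ↔ x` also has `(γ₀)_v ↔ x′`, and back).
[cite: Rogawski1990, §4.3 pp. 43–44; §3.1 p. 19] -/
theorem singularGuardSet_eq_of_corresponds {x x' : (UnitaryGroup.cmDatum L 3 H').Local v}
    (h : Corresponds (UnitaryGroup.conjLocal L (IsCMField.complexConj L) v)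
      ((UnitaryGroup.adelicForm L 3 H').map (UnitaryGroup.adeleToLocal L v))
      ((UnitaryGroup.adelicForm L 3 H').map (UnitaryGroup.adeleToLocal L v)) x x') :
    singularGuardSet L H' v x = singularGuardSet L H' v x' := by
  ext γ₀
  rw [mem_singularGuardSet_iff, mem_singularGuardSet_iff]
  exact ⟨fun hγ => ⟨hγ.1, Corresponds.trans' hγ.2 h⟩, fun hγ => ⟨hγ.1, Corresponds.trans' hγ.2 (Corresponds.symm' h)⟩⟩

/-- **THE LEVEL SCALAR IS A LOCAL-`↔`-INVARIANT**: `x ↔ x′ ⇒ M_v(x) = M_v(x′)` (§1 + ★ `levelScalar_congr`); in particular `M_v` is constant on every local stable class.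
[cite: Rogawski1990, §1.7 p. 6; §4.3 pp. 43–44] [cite: Kottwitz1986, Prop. 7.1] -/
theorem levelScalar_eq_of_corresponds {x x' : (UnitaryGroup.cmDatum L 3 H').Local v}
    (h : Corresponds (UnitaryGroup.conjLocal L (IsCMField.complexConj L) v)
      ((UnitaryGroup.adelicForm L 3 H').map (UnitaryGroup.adeleToLocal L v))
      ((UnitaryGroup.adelicForm L 3 H').map (UnitaryGroup.adeleToLocal L v)) x x') :
    levelScalar L H' v x = levelScalar L H' v x' :=
  levelScalar_congr L H' v (singularGuardSet_eq_of_corresponds h)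

/-! ## §2 Rational stable conjugacy: the (Z3) feed -/

/-- **Stably conjugate rational elements have the same guard set at every finite place** (a global `∼_st` = `Corresponds` on one group localises, ★ `corresponds_toLocal_toAdelic`).
[cite: Rogawski1990, §3.1 p. 19; §14.1 p. 232] -/
theorem singularGuardSet_toLocal_toAdelic_eq_of_isStablyConj {γ γ' : (UnitaryGroup.cmDatum L 3 H').Rational} (h : IsStablyConj (cmConjRingHom L) H' γ γ')
    (v : HeightOneSpectrum (𝓞 ↥(maximalRealSubfield L))) :
    singularGuardSet L H' v ((UnitaryGroup.cmDatum L 3 H').toLocal v ((UnitaryGroup.cmDatum L 3 H').toAdelic γ)) =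
      singularGuardSet L H' v ((UnitaryGroup.cmDatum L 3 H').toLocal v ((UnitaryGroup.cmDatum L 3 H').toAdelic γ')) :=
  singularGuardSet_eq_of_corresponds (corresponds_toLocal_toAdelic (corresponds_self_iff.2 h) v)

/-- **Stably conjugate rational elements carry the same level scalar at every finite place**: `γ ∼_st γ′ ⇒ M_v((γ)_v) = M_v((γ′)_v)` for all `v`.
[cite: Rogawski1990, §3.1 p. 19; §1.7 p. 6; §14.5 Lemma 14.5.2 (b) pp. 238–239] -/
theorem levelScalar_toLocal_toAdelic_eq_of_isStablyConj {γ γ' : (UnitaryGroup.cmDatum L 3 H').Rational} (h : IsStablyConj (cmConjRingHom L) H' γ γ')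
    (v : HeightOneSpectrum (𝓞 ↥(maximalRealSubfield L))) :
    levelScalar L H' v ((UnitaryGroup.cmDatum L 3 H').toLocal v ((UnitaryGroup.cmDatum L 3 H').toAdelic γ)) =
      levelScalar L H' v ((UnitaryGroup.cmDatum L 3 H').toLocal v ((UnitaryGroup.cmDatum L 3 H').toAdelic γ')) :=
  levelScalar_congr L H' v (singularGuardSet_toLocal_toAdelic_eq_of_isStablyConj h v)

variable (L H')

/-- **(Z3) FEED «LEVEL-SCALAR STABILITY» IN X1'S OWN BINDERS**: for two conjugacy classes `c, c′` of `U(H′)(L⁺)` with the SAME STABLE CLASS, the level scalars of the local images of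
their representatives agree at every finite place: `M_v((out c)_v) = M_v((out c′)_v)` (★ `isStablyConj_out_of_stableClass_eq` + the previous head).  Hence the scalar `∏′_v λ_v M_v`
separating the `t^J`-tower of X1 from Weil's `λ`-tower is the same for `c` and `c′`. [cite: Rogawski1990, §14.5 Lemma 14.5.2 (b) pp. 238–239; §3.1 p. 19; §1.7 p. 6] -/
theorem levelScalar_toLocal_toAdelic_out_eq_of_stableClass_eq (c c' : ConjClasses (UnitaryGroup.cmDatum L 3 H').Rational)
    (hst : StableClass.ofConjClass c = StableClass.ofConjClass c') (v : HeightOneSpectrum (𝓞 ↥(maximalRealSubfield L))) :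
    levelScalar L H' v ((UnitaryGroup.cmDatum L 3 H').toLocal v ((UnitaryGroup.cmDatum L 3 H').toAdelic (Quotient.out c))) =
      levelScalar L H' v ((UnitaryGroup.cmDatum L 3 H').toLocal v ((UnitaryGroup.cmDatum L 3 H').toAdelic (Quotient.out c'))) :=
  levelScalar_toLocal_toAdelic_eq_of_isStablyConj (isStablyConj_out_of_stableClass_eq L H' c c' hst) v

end Literature.NumberTheory.Rogawski1990.TamagawaFinPartners

end
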